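import Summits.BirchSwinnertonDyer.Rank1Residual.X12.InertCoreStepL
import Summits.BirchSwinnertonDyer.Rank1Residual.X12.InertBadOddPrime
import Literature.NumberTheory.EllipticCurves.ManinConstantNonPotentiallyOrdinaryPrimes
import Literature.NumberTheory.EllipticCurves.DeuringSupersingularReduction
import Literature.NumberTheory.EllipticCurves.Wuthrich2014.ShaBoundProofs
import Literature.NumberTheory.EllipticCurves.AnalyticRankOrderProofs
import HarnessLib

/-!
# X12 inert-bad core at `p ≥ 11`: the Kolyvagin (upper) half of `BSD(E,p)` WITHOUT the Manin datum,
# for the strong (`X₀(N)`-optimal) curve — Edixhoven 1991 Thm. 3 + Deuring's criterion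

HONEST FRAMING (cell `b2b-bsdres`, run/shared/lean/b2b/bsd-rank1-residual/, verbatim in every
file): the goal of the cell is to DELETE the COMBINATION-SHAPED residual classes of the
Birch–Swinnerton-Dyer formula for ALL analytic-rank `≤ 1` elliptic curves over `ℚ` — "full BSD
formula for every rank `≤ 1` curve in class `C`" assembled STRICTLY from published theorems — so
that the rank-`≤ 1` remainder becomes exactly the CONSTRUCTION-SHAPED classes, which are TYPED
(missing-input `Prop`s), NOT attempted. This is not "finishing BSD". Class X12 (RESIDUAL-CASES §a.2:
`cm ∧ r = 1 ∧ (p = 2 ∨ (p ∣ N ∧ p not split in K))`) is CONSTRUCTION-SHAPED and stays so; this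
file is a research-route record of the unit `b2b-bsdres-x1b` (X12 prover owner, gen 16); no claim
beyond the stated class; nothing here is booked.

WHAT THIS FILE REMOVES. Every class-level theorem of the X12 inert-bad core so far
(`InertCoreUpperHalf`, `InertCoreUpperHalfTam`, `InertCoreStepL`, `InertBadOddPrime[StepL]`) carries
ONE non-published, non-class binder: a modular parametrisation datum `D` of level `N_E` with
`p ∤ c(D)` (the MANIN DATUM), discharged so far only PER PAIR from Cremona's table / Agashe–Ribet–Stein
2006 Thm. 2.6 (`N ≤ 130000`; `InertCoreRecords`, `InertCoreInstances{A..H}`). Here it is discharged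
CLASS-WIDE at every `p ≥ 11`, for the STRONG curve of the class, from two PUBLISHED facts:
* Edixhoven 1991, Thm. 3 (`ModularForms.edixhoven_not_dvd_maninConstant_of_not_potentiallyGoodOrdinary`,
  `ManinConstantNonPotentiallyOrdinaryPrimes.lean`): for a strong parametrisation and a prime
  `p > 7`, `p ∤ c` unless `E` has potentially (good) ordinary reduction at `p` (of type II, III, IV);
* Deuring's criterion (`deuring_not_hasUnitRootAt_of_hasCM_of_not_cmSplit`,
  `DeuringSupersingularReduction.lean`; Lang, *Elliptic Functions*, Ch. 13 §4 Thm. 12): a CM curve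
  reduces SUPERSINGULARLY at every place of good reduction above a prime that does not split in the
  CM field — so an X12 inert (or ramified) pair is never potentially ordinary at `p`, and Edixhoven's
  exceptional clause is void.
"Strong" is rendered, as in `ManinConstantSemistablePrimewise.lean`, by the lattice condition
`Λ_E ⊆ c·Λ_f` on the datum `D` at the conductor level (hypothesis `hopt`, spelled out in each
theorem; no definition is introduced): it says `φ_D` is the `X₀(N)`-optimal parametrisation;
every isogeny class of modular curves has such a member (the strong Weil curve), and `BSD(E,p)` is
isogeny-invariant (Cassels), so for the census this is no restriction at class granularity — but
the theorems below are stated, as they are proved, for the optimal `W` only.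

CONTENTS (all binders PUBLISHED named facts of the tree: `hGZ` Gross–Zagier, `hKo` Kolyvagin, `hMN`
Matar–Nekovář 2019 Thm. 0.3 (irreducible form), `hGZK`, `hmod`/`hnf` modularity, `hFH`
Friedberg–Hoffstein, `hCM8` Rubin 1991 + Burungale–Flach 2024 (rank-0 CM), and the two new ones
`hEdx`, `hDeu`):
* `not_potentiallyGoodOrdinary_of_hasCM_of_not_cmSplit` — CM ∧ `p` non-split ⟹ no subfield `F` of a
  `p`-th cyclotomic field over which `E_F` is good ordinary above `p` (the (G)-ordinary shape of
  `Additive/PotGoodOrdinary.lean` / `Delbourgo1998`), from `hDeu` and the existence of a place of `F`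
  above `p`;
* `not_dvd_maninConstant_of_hasCM_of_not_cmSplit_of_optimal` — `p > 7`, CM, `p` non-split,
  `D` optimal ⟹ `p ∤ c(D)` (`hEdx` + the previous);
* `missingUpperBoundAt_of_classX12_of_cmInert_of_optimal` — THE MANIN-FREE UPPER HALF:
  `ClassX12 W p ∧ 7 < p ∧ ¬CMRamified ∧ ¬CMSplit` (the inert-bad core at `p ≥ 11`), `D` optimal ⟹
  `MissingUpperBoundAt W p` (`ord_p #Ш(E) ≤ ord_p #Ш(E)_an`);
* `bsdp_of_classX12_of_cmInert_of_optimal_of_lower`, `missingInputAt_…_of_lower`,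
  `bsdp_iff_missingLowerBoundAt_of_classX12_of_cmInert_of_optimal`,
  `bsdp_iff_forall_indexLowerBoundAt_of_classX12_of_cmInert_of_optimal` — the gen-9/10/12
  sentences with the Manin binder GONE: on the inert core at `p ≥ 11`, for the strong curve,
  `BSD(E,p) ⟺ own lower half ⟺ STEP L at every Friedberg–Hoffstein Heegner datum`, from published
  facts ALONE;
* `bsdp_of_isIsogenous_of_classX12_of_cmInert_of_optimal_of_lower` — every member `W ∼ W₀` of the
  class: `BSDp W p` from the strong curve's lower half (Cassels' invariance `hCassels`, through
  `Wuthrich2014.bsdp_of_isIsogenous`).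
READING (no label change): the X12 inert-bad core's typed residue at `p ≥ 11` is the lower half /
STEP L with NO auxiliary datum left for the strong curve; at `p ∈ {5, 7}` (42 of the 72 window
pairs) the Manin datum remains (Edixhoven's `p > 7`; per pair it is Cremona's table), as it does for
non-optimal members only through §3 (Cassels' invariance of `BSD(E,p)`; the one-sided halves
themselves are not transported).

References: B. Edixhoven, Progr. Math. 89 (1991) 25–39, Thm. 3; S. Lang, *Elliptic Functions*
(GTM 112, 1987) Ch. 13 §4 Thm. 12; A. Matar, J. Nekovář, JTNB 31 (2019) Thm. 0.3, §0.11;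
A. Burungale, M. Flach, Camb. J. Math. 12 (2024) Cor. 2; K. Rubin, Invent. Math. 103 (1991)
Thm. 11.1; D. Jetchev, C. Skinner, X. Wan, Camb. J. Math. 5 (2017) §7.4.2; HOME
`b2b-bsdres-x1b/X12-ROUTE.md` §20.
-/

noncomputable section

open scoped Classical NumberField

open WeierstrassCurve NumberField IsDedekindDomain Literature.NumberTheory.EllipticCurves
  Literature.NumberTheory.EllipticCurves.ModularForms
  Literature.NumberTheory.EllipticCurves.Rank1Residual
  Literature.NumberTheory.EllipticCurves.Rank1Residual.Typed
  Literature.NumberTheory.Automorphic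

namespace Summit.BirchSwinnertonDyer.Rank1Residual.X12

/-! ### §1 Optimal (strong) data and the two published inputs -/

/-- **A CM curve at a non-split prime is not potentially good ordinary** (in the (G)-ordinary
transcription of `Additive/PotGoodOrdinary.lean` / `Delbourgo1998`): there is no subfield `F` of a
`p`-th cyclotomic field over which `E_F` has good reduction with the unit-root condition at every
place above `p`. From Deuring's criterion `hDeu` at any place `w ∣ p` of such an `F` (one exists:
`exists_heightOneSpectrum_natCast_mem`). [cite: Lang1987, Ch. 13 §4 Thm. 12] -/
theorem not_potentiallyGoodOrdinary_of_hasCM_of_not_cmSplit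
    (hDeu : deuring_not_hasUnitRootAt_of_hasCM_of_not_cmSplit)
    (W : WeierstrassCurve ℚ) [W.IsElliptic] (hCM : W.HasCM) (p : ℕ) [Fact p.Prime]
    (hns : ¬ CMSplit W p) :
    ¬ ∃ (L : Type) (_ : Field L) (_ : NumberField L) (_ : IsCyclotomicExtension {p} ℚ L)
        (F : IntermediateField ℚ L),
        ∀ w : HeightOneSpectrum (𝓞 F), (p : 𝓞 F) ∈ w.asIdeal →
          (W.baseChange F).HasGoodReductionAt w ∧ (W.baseChange F).HasUnitRootAt w := by
  rintro ⟨L, _, _, _, F, hF⟩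
  obtain ⟨w, hw⟩ := exists_heightOneSpectrum_natCast_mem (K := F) (Fact.out : p.Prime)
  obtain ⟨hgood, hunit⟩ := hF w hw
  exact hDeu W hCM p Fact.out hns F w hw hgood hunit

/-- **The Manin constant of the strong curve of a CM class is prime to every non-split `p > 7`**
(Edixhoven 1991 Thm. 3 `hEdx` + Deuring `hDeu`): for `W/ℚ` globally minimal with CM, a prime
`p > 7` that does not split in the CM field, and an OPTIMAL datum `D` of level `N_E`: `p ∤ c(D)`.
[cite: EdixhovenManin1991, Thm. 3] [cite: Lang1987, Ch. 13 §4 Thm. 12] -/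
theorem not_dvd_maninConstant_of_hasCM_of_not_cmSplit_of_optimal
    (hEdx : edixhoven_not_dvd_maninConstant_of_not_potentiallyGoodOrdinary)
    (hDeu : deuring_not_hasUnitRootAt_of_hasCM_of_not_cmSplit)
    (W : WeierstrassCurve ℚ) [W.IsElliptic] [W.IsGloballyMinimal] [NeZero (W.conductorNorm ℤ)]
    (p : ℕ) [Fact p.Prime] (hCM : W.HasCM) (hp7 : 7 < p) (hns : ¬ CMSplit W p)
    (D : ModularParametrizationData W (W.conductorNorm ℤ))
    (hopt : ∀ z ∈ D.L.lattice, ∃ w ∈ periodLattice D.f, z = D.c * w) :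
    ¬ (p : ℤ) ∣ D.c :=
  hEdx W D hopt p Fact.out hp7
    (not_potentiallyGoodOrdinary_of_hasCM_of_not_cmSplit hDeu W hCM p hns)

/-! ### §2 The Manin-free upper half and its corollaries on the inert core at `p ≥ 11` -/

/-- **X12 INERT-BAD CORE, `p ≥ 11`, STRONG CURVE: THE UPPER HALF OF `BSD(E,p)` FROM PUBLISHED FACTS
ALONE — no Manin datum, no Tamagawa datum, no table.** For `W/ℚ` globally minimal with
`ClassX12 W p` (CM, `r_an = 1`), `7 < p`, `p` INERT in the CM field (`¬CMRamified ∧ ¬CMSplit`), and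
an optimal datum `D` of level `N_E`: `MissingUpperBoundAt W p`, i.e. `#Ш(E)_an = q ∈ ℚ` and
`ord_p #Ш(E) ≤ ord_p q`. Proof: `missingUpperBoundAt_of_classX12_of_not_cmRamified'`
(Kolyvagin–Matar–Nekovář over a Friedberg–Hoffstein field, the twist's half by Rubin/Burungale–Flach,
`p ∤ ∏c_ℓ` by Kodaira–Néron) with its Manin hypothesis supplied by
`not_dvd_maninConstant_of_hasCM_of_not_cmSplit_of_optimal`.
[cite: EdixhovenManin1991, Thm. 3] [cite: MatarNekovar2019, Thm. 0.3 and §0.11]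
[cite: BurungaleFlach2024, Thm. 1.1 and Cor. 2] [cite: Lang1987, Ch. 13 §4 Thm. 12] -/
theorem missingUpperBoundAt_of_classX12_of_cmInert_of_optimal
    (hGZ : ∀ (N : ℕ) [NeZero N] (W : WeierstrassCurve ℚ) (K : Type) [Field K] [NumberField K],
      gross_zagier N W K)
    (hKo : ∀ (N : ℕ) [NeZero N] (W : WeierstrassCurve ℚ) (K : Type) [Field K] [NumberField K],
      kolyvagin N W K)
    (hMN : ∀ (N : ℕ) [NeZero N] (W : WeierstrassCurve ℚ) (K : Type) [Field K] [NumberField K],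
      MatarNekovar2019.thm03_padicValNat_card_sha_le_of_irreducible N W K)
    (hGZK : rank_eq_analyticRank_of_analyticRank_le_one) (hmod : hasEntireLFunction_rat)
    (hnf : exists_isNewformOf) (hFH : friedbergHoffstein_exists_heegnerField_split_twist_ne_zero)
    (hCM8 : bsdTriple_of_hasCM_of_L_one_ne_zero)
    (hEdx : edixhoven_not_dvd_maninConstant_of_not_potentiallyGoodOrdinary)
    (hDeu : deuring_not_hasUnitRootAt_of_hasCM_of_not_cmSplit)
    (W : WeierstrassCurve ℚ) [W.IsElliptic] [W.IsGloballyMinimal] (p : ℕ) [Fact p.Prime]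
    [NeZero (W.conductorNorm ℤ)]
    (hX : ClassX12 W p) (hp7 : 7 < p) (hnr : ¬ CMRamified W p) (hns : ¬ CMSplit W p)
    (D : ModularParametrizationData W (W.conductorNorm ℤ))
    (hopt : ∀ z ∈ D.L.lattice, ∃ w ∈ periodLattice D.f, z = D.c * w) :
    MissingUpperBoundAt W p :=
  missingUpperBoundAt_of_classX12_of_not_cmRamified' hGZ hKo hMN hGZK hmod hnf hFH hCM8 W p hX
    (by omega) hnr D
    (not_dvd_maninConstant_of_hasCM_of_not_cmSplit_of_optimal hEdx hDeu W p hX.1 hp7 hns D hopt)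

/-- **`BSD(E,p)` on the inert core at `p ≥ 11` for the strong curve, from the pair's OWN LOWER half
alone** (no Manin datum).
[cite: EdixhovenManin1991, Thm. 3] [cite: MatarNekovar2019, Thm. 0.3 and §0.11] -/
theorem bsdp_of_classX12_of_cmInert_of_optimal_of_lower
    (hGZ : ∀ (N : ℕ) [NeZero N] (W : WeierstrassCurve ℚ) (K : Type) [Field K] [NumberField K],
      gross_zagier N W K)
    (hKo : ∀ (N : ℕ) [NeZero N] (W : WeierstrassCurve ℚ) (K : Type) [Field K] [NumberField K],
      kolyvagin N W K)
    (hMN : ∀ (N : ℕ) [NeZero N] (W : WeierstrassCurve ℚ) (K : Type) [Field K] [NumberField K],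
      MatarNekovar2019.thm03_padicValNat_card_sha_le_of_irreducible N W K)
    (hGZK : rank_eq_analyticRank_of_analyticRank_le_one) (hmod : hasEntireLFunction_rat)
    (hnf : exists_isNewformOf) (hFH : friedbergHoffstein_exists_heegnerField_split_twist_ne_zero)
    (hCM8 : bsdTriple_of_hasCM_of_L_one_ne_zero)
    (hEdx : edixhoven_not_dvd_maninConstant_of_not_potentiallyGoodOrdinary)
    (hDeu : deuring_not_hasUnitRootAt_of_hasCM_of_not_cmSplit)
    (W : WeierstrassCurve ℚ) [W.IsElliptic] [W.IsGloballyMinimal] (p : ℕ) [Fact p.Prime]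
    [NeZero (W.conductorNorm ℤ)]
    (hX : ClassX12 W p) (hp7 : 7 < p) (hnr : ¬ CMRamified W p) (hns : ¬ CMSplit W p)
    (D : ModularParametrizationData W (W.conductorNorm ℤ))
    (hopt : ∀ z ∈ D.L.lattice, ∃ w ∈ periodLattice D.f, z = D.c * w)
    (hlow : MissingLowerBoundAt W p) : BSDp W p :=
  bsdp_of_classX12_of_not_cmRamified_of_lower' hGZ hKo hMN hGZK hmod hnf hFH hCM8 W p hX
    (by omega) hnr D
    (not_dvd_maninConstant_of_hasCM_of_not_cmSplit_of_optimal hEdx hDeu W p hX.1 hp7 hns D hopt) hlow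

/-- **The cell's typed input `X12.MissingInputAt W p` on the inert core at `p ≥ 11` for the strong
curve FOLLOWS from the pair's own lower half** — no Manin datum. Consumer:
`Typed.X12.bsdp_of_missingInputAt`. X12 stays CONSTRUCTION-SHAPED; nothing booked.
[cite: EdixhovenManin1991, Thm. 3] [cite: MatarNekovar2019, Thm. 0.3 and §0.11] -/
theorem missingInputAt_of_classX12_of_cmInert_of_optimal_of_lower
    (hGZ : ∀ (N : ℕ) [NeZero N] (W : WeierstrassCurve ℚ) (K : Type) [Field K] [NumberField K],
      gross_zagier N W K)
    (hKo : ∀ (N : ℕ) [NeZero N] (W : WeierstrassCurve ℚ) (K : Type) [Field K] [NumberField K],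
      kolyvagin N W K)
    (hMN : ∀ (N : ℕ) [NeZero N] (W : WeierstrassCurve ℚ) (K : Type) [Field K] [NumberField K],
      MatarNekovar2019.thm03_padicValNat_card_sha_le_of_irreducible N W K)
    (hGZK : rank_eq_analyticRank_of_analyticRank_le_one) (hmod : hasEntireLFunction_rat)
    (hnf : exists_isNewformOf) (hFH : friedbergHoffstein_exists_heegnerField_split_twist_ne_zero)
    (hCM8 : bsdTriple_of_hasCM_of_L_one_ne_zero)
    (hEdx : edixhoven_not_dvd_maninConstant_of_not_potentiallyGoodOrdinary)
    (hDeu : deuring_not_hasUnitRootAt_of_hasCM_of_not_cmSplit)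
    (W : WeierstrassCurve ℚ) [W.IsElliptic] [W.IsGloballyMinimal] (p : ℕ) [Fact p.Prime]
    [NeZero (W.conductorNorm ℤ)]
    (hX : ClassX12 W p) (hp7 : 7 < p) (hnr : ¬ CMRamified W p) (hns : ¬ CMSplit W p)
    (D : ModularParametrizationData W (W.conductorNorm ℤ))
    (hopt : ∀ z ∈ D.L.lattice, ∃ w ∈ periodLattice D.f, z = D.c * w)
    (hlow : MissingLowerBoundAt W p) : X12.MissingInputAt W p := fun _ ↦
  missingPPartAt_of_lower_of_upper W p hlow
    (missingUpperBoundAt_of_classX12_of_cmInert_of_optimal hGZ hKo hMN hGZK hmod hnf hFH hCM8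
      hEdx hDeu W p hX hp7 hnr hns D hopt)

/-- **On the inert core at `p ≥ 11`, for the strong curve: `BSD(E,p) ⟺ MissingLowerBoundAt W p`**
— the class sentence of `InertBadOddPrime` (p224495) with the Manin binder removed.
[cite: EdixhovenManin1991, Thm. 3] [cite: MatarNekovar2019, Thm. 0.3 and §0.11] -/
theorem bsdp_iff_missingLowerBoundAt_of_classX12_of_cmInert_of_optimal
    (hGZ : ∀ (N : ℕ) [NeZero N] (W : WeierstrassCurve ℚ) (K : Type) [Field K] [NumberField K],
      gross_zagier N W K)
    (hKo : ∀ (N : ℕ) [NeZero N] (W : WeierstrassCurve ℚ) (K : Type) [Field K] [NumberField K],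
      kolyvagin N W K)
    (hMN : ∀ (N : ℕ) [NeZero N] (W : WeierstrassCurve ℚ) (K : Type) [Field K] [NumberField K],
      MatarNekovar2019.thm03_padicValNat_card_sha_le_of_irreducible N W K)
    (hGZK : rank_eq_analyticRank_of_analyticRank_le_one) (hmod : hasEntireLFunction_rat)
    (hnf : exists_isNewformOf) (hFH : friedbergHoffstein_exists_heegnerField_split_twist_ne_zero)
    (hCM8 : bsdTriple_of_hasCM_of_L_one_ne_zero)
    (hEdx : edixhoven_not_dvd_maninConstant_of_not_potentiallyGoodOrdinary)
    (hDeu : deuring_not_hasUnitRootAt_of_hasCM_of_not_cmSplit)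
    (W : WeierstrassCurve ℚ) [W.IsElliptic] [W.IsGloballyMinimal] (p : ℕ) [Fact p.Prime]
    [NeZero (W.conductorNorm ℤ)]
    (hX : ClassX12 W p) (hp7 : 7 < p) (hnr : ¬ CMRamified W p) (hns : ¬ CMSplit W p)
    (D : ModularParametrizationData W (W.conductorNorm ℤ))
    (hopt : ∀ z ∈ D.L.lattice, ∃ w ∈ periodLattice D.f, z = D.c * w) :
    BSDp W p ↔ MissingLowerBoundAt W p :=
  bsdp_iff_missingLowerBoundAt_of_classX12_of_bad_odd hGZ hKo hMN hGZK hmod hnf hFH hCM8 W p hX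
    (by rintro rfl; omega) (not_good_of_classX12_of_not_cmRamified W p hX (by omega) hnr) hnr D
    (not_dvd_maninConstant_of_hasCM_of_not_cmSplit_of_optimal hEdx hDeu W p hX.1 hp7 hns D hopt)
    (not_dvd_tamagawaProduct_of_hasCM W hX.1 p (by omega))

/-- **On the inert core at `p ≥ 11`, for the strong curve: `BSD(E,p) ⟺ STEP L at every
Friedberg–Hoffstein Heegner datum** (`|d_{K'}| > 4`, Heegner hypothesis, `L(E^{(d)},1) ≠ 0`) — the
gen-10 sentence `bsdp_iff_forall_indexLowerBoundAt_of_classX12_of_not_cmRamified` (p216946) with the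
Manin binder removed. So the X12 inert core's residue at `p ≥ 11` reads, for the strong curve and
from PUBLISHED facts only: `BSD(E,p) ⟺ X11b.IndexLowerBoundAt` (= Kolyvagin's conjecture `m_∞ = 0`
there, memo §11) — one and the same typed input as class X11b, with NO auxiliary datum.
[cite: EdixhovenManin1991, Thm. 3] [cite: MatarNekovar2019, Thm. 0.3, Thm. 0.7 and §0.11]
[cite: JetchevSkinnerWan2017, §7.4.1 (eq. shalowerK-1)] -/
theorem bsdp_iff_forall_indexLowerBoundAt_of_classX12_of_cmInert_of_optimal
    (hGZ : ∀ (N : ℕ) [NeZero N] (W : WeierstrassCurve ℚ) (K : Type) [Field K] [NumberField K],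
      gross_zagier N W K)
    (hKo : ∀ (N : ℕ) [NeZero N] (W : WeierstrassCurve ℚ) (K : Type) [Field K] [NumberField K],
      kolyvagin N W K)
    (hMN : ∀ (N : ℕ) [NeZero N] (W : WeierstrassCurve ℚ) (K : Type) [Field K] [NumberField K],
      MatarNekovar2019.thm03_padicValNat_card_sha_le_of_irreducible N W K)
    (hGZK : rank_eq_analyticRank_of_analyticRank_le_one) (hmod : hasEntireLFunction_rat)
    (hnf : exists_isNewformOf) (hFH : friedbergHoffstein_exists_heegnerField_split_twist_ne_zero)
    (hCM8 : bsdTriple_of_hasCM_of_L_one_ne_zero)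
    (hEdx : edixhoven_not_dvd_maninConstant_of_not_potentiallyGoodOrdinary)
    (hDeu : deuring_not_hasUnitRootAt_of_hasCM_of_not_cmSplit)
    (W : WeierstrassCurve ℚ) [W.IsElliptic] [W.IsGloballyMinimal] (p : ℕ) [Fact p.Prime]
    [NeZero (W.conductorNorm ℤ)]
    (hX : ClassX12 W p) (hp7 : 7 < p) (hnr : ¬ CMRamified W p) (hns : ¬ CMSplit W p)
    (D : ModularParametrizationData W (W.conductorNorm ℤ))
    (hopt : ∀ z ∈ D.L.lattice, ∃ w ∈ periodLattice D.f, z = D.c * w) :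
    BSDp W p ↔
      ∀ (K : Type) [Field K] [NumberField K]
        (H : HeegnerDatum (W.conductorNorm ℤ) (NumberField.discr K)) (ι : K →+* ℂ)
        (P : (W.baseChange K).toAffine.Point),
        IsImaginaryQuadratic K → SatisfiesHeegnerHypothesis (W.conductorNorm ℤ) K →
        4 < (NumberField.discr K).natAbs →
        WeierstrassCurve.Affine.Point.map ι.toRatAlgHom P = heegnerPointComplex D H →
        (W.quadraticTwist (NumberField.discr K : ℚ)).entireLFunction 1 ≠ 0 →
        (Finite (W.baseChange K).sha → X11b.IndexLowerBoundAt W p K P) :=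
  bsdp_iff_forall_indexLowerBoundAt_of_classX12_of_not_cmRamified hGZ hKo hMN hGZK hmod hnf hFH hCM8
    W p hX (by omega) hnr D
    (not_dvd_maninConstant_of_hasCM_of_not_cmSplit_of_optimal hEdx hDeu W p hX.1 hp7 hns D hopt)


/-! ### §3 Every member of the class: Cassels' isogeny invariance of `BSD(E,p)` -/

/-- **Every curve of an X12 inert-core class at `p ≥ 11`: `BSD(W,p)` from the STRONG curve's own
lower half** — for `W/ℚ` globally minimal, `ℚ`-isogenous to the strong curve `W₀` of the class
(`ClassX12 W₀ p`, `7 < p`, `p` inert in the CM field, `D₀` an optimal datum of level `N`), the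
strong curve's `MissingLowerBoundAt W₀ p` gives `BSDp W p`. One more PUBLISHED binder: Cassels'
isogeny invariance of the BSD quotient (`WeierstrassCurve.bsdRHS_eq_of_isIsogenous`), through the
tree theorem `Wuthrich2014.bsdp_of_isIsogenous`; `Ш(W₀)` finite by GZK at `r_an = 1`,
`L'(W₀,1) ≠ 0` by `leadingLCoeff_ne_zero_holds`. So at class granularity (every isogeny class has a
strong member) the Manin datum is gone from the X12 inert core at `p ≥ 11`.
[cite: Cassels1965ArithmeticVIII] [cite: MilneADT2006, Thm. I.7.3 and Remark I.7.4]
[cite: EdixhovenManin1991, Thm. 3] [cite: MatarNekovar2019, Thm. 0.3 and §0.11] -/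
theorem bsdp_of_isIsogenous_of_classX12_of_cmInert_of_optimal_of_lower
    (hGZ : ∀ (N : ℕ) [NeZero N] (W : WeierstrassCurve ℚ) (K : Type) [Field K] [NumberField K],
      gross_zagier N W K)
    (hKo : ∀ (N : ℕ) [NeZero N] (W : WeierstrassCurve ℚ) (K : Type) [Field K] [NumberField K],
      kolyvagin N W K)
    (hMN : ∀ (N : ℕ) [NeZero N] (W : WeierstrassCurve ℚ) (K : Type) [Field K] [NumberField K],
      MatarNekovar2019.thm03_padicValNat_card_sha_le_of_irreducible N W K)
    (hGZK : rank_eq_analyticRank_of_analyticRank_le_one) (hmod : hasEntireLFunction_rat)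
    (hnf : exists_isNewformOf) (hFH : friedbergHoffstein_exists_heegnerField_split_twist_ne_zero)
    (hCM8 : bsdTriple_of_hasCM_of_L_one_ne_zero)
    (hEdx : edixhoven_not_dvd_maninConstant_of_not_potentiallyGoodOrdinary)
    (hDeu : deuring_not_hasUnitRootAt_of_hasCM_of_not_cmSplit)
    (hCassels : bsdRHS_eq_of_isIsogenous)
    {W W₀ : WeierstrassCurve ℚ} [W.IsElliptic] [W₀.IsElliptic] [W.IsGloballyMinimal]
    [W₀.IsGloballyMinimal] (p : ℕ) [Fact p.Prime] [NeZero (W₀.conductorNorm ℤ)]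
    (hiso : IsIsogenous W W₀) (hX : ClassX12 W₀ p) (hp7 : 7 < p) (hnr : ¬ CMRamified W₀ p)
    (hns : ¬ CMSplit W₀ p) (D₀ : ModularParametrizationData W₀ (W₀.conductorNorm ℤ))
    (hopt : ∀ z ∈ D₀.L.lattice, ∃ w ∈ periodLattice D₀.f, z = D₀.c * w)
    (hlow : MissingLowerBoundAt W₀ p) : BSDp W p :=
  Wuthrich2014.bsdp_of_isIsogenous hCassels hiso (hGZK W₀ (by rw [hX.2.1])).2
    (W₀.leadingLCoeff_ne_zero_holds (hmod W₀))
    (bsdp_of_classX12_of_cmInert_of_optimal_of_lower hGZ hKo hMN hGZK hmod hnf hFH hCM8 hEdx hDeu W₀ p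
      hX hp7 hnr hns D₀ hopt hlow)

end Summit.BirchSwinnertonDyer.Rank1Residual.X12

end
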